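import Summits.BirchSwinnertonDyer.BirchSwinnertonDyer.Theorems.BiquadraticEisensteinDescentEisensteinHeartFlatCMInertBadKPrimeIndexTwoRestriction
import Summits.BirchSwinnertonDyer.Rank1Residual.X11b.AnticyclotomicSelmerDual
import HarnessLib

set_option linter.dupNamespace false -- `Summit.BirchSwinnertonDyer.BirchSwinnertonDyer.Theorems.…` (summit = sub)
set_option autoImplicit false

/-!
# Crux `EisensteinHeartFlatCMInertBadKPrime` (stmt-BirchSwinnertonDyer-21341), line `hsieh-lambda`, layer 2 (V3), part 6:
# the `Γ`-action on `Sel_𝔭^Σ(K̄^{H′}, M)` for an intermediate normal subgroup `H′ ≤ ker κ` (the upper field `L·K′_∞`):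
# local nilpotence of `γ − 1`, and coefficient endomorphisms (the CM action) on Castella's Selmer groups

Route `BiquadraticEisensteinDescent` (cell `pub/bsd-wall`, width-prover seat `bsd-wall-cm-bed-w1` g5, D-0152 M1). Second
Galois-cohomological input of the datum `(N, σ, g)` for the landed `…ShapiroSocket` (p600402): the `Λ = ℤ_p⟦T⟧`-structure on the
Pontryagin dual `X_L = Hom(Sel_𝔭^Σ(K̄^{H′}, M), ℚ/ℤ)` for `H′ = ker κ ∩ Γ_L` (the tree's `IwasawaDual.IsLocNil.module` needs
«`p`-power torsion + `(γ − 1)`-local nilpotence», proved here for ANY closed normal `H′ = ker κ ∩ R` with `κ|_R` onto and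
`γ ∈ R`), and the endomorphism of `Sel_𝔭^Σ(K̄^{H′}, M)` induced by an `H′`-equivariant coefficient map `φ : M → M` which every
`σ ∈ Γ_K` either commutes or ANTI-commutes with (the CM endomorphism `[√d]` over the Heegner field: `σ[√d]σ⁻¹ = ±[√d]`).

* §1 `exists_openNormalSubgroup_conjH1_eq`, `exists_conjH1_pow_prime_pow_eq` — continuity of the `Γ_K/H′`-action on
  `H¹(H′, M)` and «`γ^{p^a}` fixes every class» (the tree's (A1)/(A2) of `IwasawaSelmerDualProofs` /
  `GreenbergSelmerDualDataExistsProofs`, there for `H′ = ker κ` only).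
* §2 `isLocNil_conjH1_codRestrict_sub_one` — for every `conj_γ`-stable subgroup `S ≤ H¹(H′, M)` (e.g. a Selmer group),
  `IwasawaDual.IsLocNil p (conj_γ|_S − 1)`; `nsmul_bijective_of_isPrimary` — `n` prime to `p` is invertible on a `p`-primary `M`.
* §3 `coeffH1` calculus (no definition: the map is `resH1Hom (id, φ)`): commutation with restriction and with the local maps,
  (anti)commutation with `conj_σ`, and `resH1Hom_coeff_mem_selmerOver` — `φ_*` preserves `Sel_𝔭^Σ(K̄^{H′}, M)`.

THEOREMS ONLY (no definition, no named fact, no instance, no `sorry`); imports no `Theses` module; nothing about the crux's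
input or any case of BSD is asserted; BSD is not proved by any of this. Supports stmt-BirchSwinnertonDyer-21341 as a helper.

References: [GreenbergLNM1716] §1 (after Conj. 1.3: "`Γ` acts … every element killed by `Tⁿ`"); [Greenberg1989] §1 p. 98;
[SerreLocalFields1979] VII.§5 Prop. 3; [NeukirchSchmidtWingberg2008] I.§5; [Castella2018] Def. 2.2; [SilvermanAEC2009] II.2
(Galois conjugates of isogenies, `(φP)^σ = φ^σ(P^σ)`).
-/

noncomputable section

open scoped Classical

universe u

open NumberField IsDedekindDomain Field
  Literature.NumberTheory.EllipticCurves Literature.NumberTheory.EllipticCurves.GreenbergSelmer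
  Literature.NumberTheory.GaloisRepresentations
  Summit.BirchSwinnertonDyer.Rank1Residual.X11b.AcSelmer

namespace Summit.BirchSwinnertonDyer.BirchSwinnertonDyer.Theorems.BiquadraticEisensteinDescentEisensteinHeartFlatCMInertBadKPrimeSelmerTower

variable {K : Type u} [Field K] [NumberField K] {p : ℕ} [Fact p.Prime]
variable (M : Type u) [AddCommGroup M] [DistribMulAction (absoluteGaloisGroup K) M] [TopologicalSpace M]
  [DiscreteTopology M]

/-! ## §1 Continuity of the `Γ_K/H′`-action on `H¹(H′, M)`; `γ^{p^a}` fixes every class -/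

section Continuity

variable (H' : Subgroup (absoluteGaloisGroup K)) [H'.Normal]

omit [Fact p.Prime] in
/-- **(A1′)** For a CLOSED normal subgroup `H′` of `Γ_K` and a discrete `M` whose points have open stabilisers, every class of
`H¹(H′, M)` is fixed by `conj_τ` for all `τ` in some open normal subgroup of `Γ_K` (the cocycle has finitely many values and
vanishes near `1`; cocycle criterion `IwasawaDual.conjH1_oneCocycleClass_eq`). Verbatim the tree's (A1) for `H′ = ker κ`.
[cite: GreenbergLNM1716, §1 (after Conj. 1.3)] [cite: NeukirchSchmidtWingberg2008, I.§5] -/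
theorem exists_openNormalSubgroup_conjH1_eq (hH'c : IsClosed (H' : Set (absoluteGaloisGroup K)))
    (hstab : ∀ m : M, IsOpen (MulAction.stabilizer (absoluteGaloisGroup K) m : Set (absoluteGaloisGroup K)))
    (c : subgroupH1 H' M) :
    ∃ Nrm : OpenNormalSubgroup (absoluteGaloisGroup K), ∀ τ ∈ Nrm, conjH1 H' M τ c = c := by
  haveI : CompactSpace H' := isCompact_iff_compactSpace.mp hH'c.isCompact
  obtain ⟨φ, rfl⟩ := oneCocycleClass_surjective _ c
  have hfin : (Set.range φ.1).Finite := (isCompact_range φ.1.continuous).finite_of_discrete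
  set Ufix : Set (absoluteGaloisGroup K) := {τ | ∀ m ∈ Set.range φ.1, τ • m = m} with hUfix_def
  have hUfix : IsOpen Ufix := by
    have e : Ufix = ⋂ m ∈ Set.range φ.1,
        (MulAction.stabilizer (absoluteGaloisGroup K) m : Set (absoluteGaloisGroup K)) := by
      ext τ
      simp only [hUfix_def, Set.mem_setOf_eq, Set.mem_iInter, SetLike.mem_coe, MulAction.mem_stabilizer_iff]
    rw [e]
    exact hfin.isOpen_biInter fun m _ ↦ hstab m
  have hz : IsOpen {h : H' | φ.1 h = 0} := (isOpen_discrete ({0} : Set M)).preimage φ.1.continuous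
  obtain ⟨U0, hU0, hU0eq⟩ := isOpen_induced_iff.mp hz
  have h1fix : (1 : absoluteGaloisGroup K) ∈ Ufix := fun m _ ↦ one_smul _ m
  have h1U0 : (1 : absoluteGaloisGroup K) ∈ U0 := by
    have : (1 : H') ∈ Subtype.val ⁻¹' U0 := by
      rw [hU0eq]
      exact contOneCocycles.apply_one φ
    exact this
  obtain ⟨Nrm, hNrm⟩ := ProfiniteGrp.exist_openNormalSubgroup_sub_open_nhds_of_one (hUfix.inter hU0) ⟨h1fix, h1U0⟩
  refine ⟨Nrm, fun τ hτ ↦ IwasawaDual.conjH1_oneCocycleClass_eq φ (fun h ↦ ?_) (fun h n hn ↦ ?_)⟩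
  · exact (hNrm hτ).1 _ ⟨h, rfl⟩
  · have hnN : (n : absoluteGaloisGroup K) ∈ Nrm := by
      rw [hn]
      have h1 : (h : absoluteGaloisGroup K)⁻¹ * τ⁻¹ * (h : absoluteGaloisGroup K)⁻¹⁻¹ ∈ Nrm.toSubgroup :=
        Subgroup.Normal.conj_mem inferInstance _ (Nrm.toSubgroup.inv_mem hτ) _
      rw [inv_inv] at h1
      exact Nrm.toSubgroup.mul_mem h1 hτ
    have hn0 : n ∈ Subtype.val ⁻¹' U0 := (hNrm hnN).2
    rw [hU0eq] at hn0
    exact hn0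

/-- **(A2′)** Let `κ` be a `ℤ_p`-extension of `K`, `R ≤ Γ_K` a subgroup on which `κ` is still onto (e.g. `R = Γ_L` for `[L : K]`
prime to `p`), `H′ = ker κ ∩ R` closed and normal (the group of `L·K_∞`), and `γ ∈ R` a topological generator of `κ`. Then
every class of `H¹(H′, M)` (points of `M` with open stabilisers) is fixed by `conj_{γ^{p^a}}` for some `a`: with `Nrm` as in
(A1′) of index `p^a e`, `p ∤ e`, pick `g₀ ∈ R` with `κ g₀ = e⁻¹`; then `τ = g₀^{[Γ:Nrm]} ∈ Nrm ∩ R`, `κ τ = κ(γ^{p^a})`, so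
`τ⁻¹ γ^{p^a} ∈ ker κ ∩ R = H′` acts trivially (`conjH1_of_mem`). [cite: GreenbergLNM1716, §1 (after Conj. 1.3)]
[cite: SerreLocalFields1979, VII.§5 Prop. 3] -/
theorem exists_conjH1_pow_prime_pow_eq (κ : ZpExtension K p) (R : Subgroup (absoluteGaloisGroup K))
    (hH' : ∀ x, x ∈ H' ↔ x ∈ κ.kerSubgroup ∧ x ∈ R)
    (hR : ∀ u : ℤ_[p], ∃ g ∈ R, κ g = Multiplicative.ofAdd u)
    (hH'c : IsClosed (H' : Set (absoluteGaloisGroup K)))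
    (hstab : ∀ m : M, IsOpen (MulAction.stabilizer (absoluteGaloisGroup K) m : Set (absoluteGaloisGroup K)))
    {γ : absoluteGaloisGroup K} (hγ : κ.IsTopGenerator γ) (hγR : γ ∈ R) (c : subgroupH1 H' M) :
    ∃ a : ℕ, conjH1 H' M (γ ^ p ^ a) c = c := by
  obtain ⟨Nrm, hNrm⟩ := exists_openNormalSubgroup_conjH1_eq M H' hH'c hstab c
  haveI : Finite (absoluteGaloisGroup K ⧸ Nrm.toSubgroup) := Subgroup.quotient_finite_of_isOpen _ Nrm.isOpen
  have hd : Nrm.toSubgroup.index ≠ 0 := Subgroup.index_ne_zero_of_finite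
  obtain ⟨a, e, he, hde⟩ := Nat.exists_eq_pow_mul_and_not_dvd hd p (Fact.out : p.Prime).ne_one
  obtain ⟨u, hu⟩ := IwasawaDual.isUnit_natCast_padicInt (p := p) he
  obtain ⟨g₀, hg₀R, hg₀⟩ := hR ((u⁻¹ : ℤ_[p]ˣ) : ℤ_[p])
  have hτN : g₀ ^ Nrm.toSubgroup.index ∈ Nrm := Nrm.toSubgroup.pow_index_mem g₀
  have hκτ : (κ (g₀ ^ Nrm.toSubgroup.index)).toAdd = (p : ℤ_[p]) ^ a := by
    rw [map_pow, hg₀, ← ofAdd_nsmul, toAdd_ofAdd, nsmul_eq_mul, hde, Nat.cast_mul, Nat.cast_pow, ← hu, mul_assoc,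
      Units.mul_inv, mul_one]
  have hκγ : (κ (γ ^ p ^ a)).toAdd = (p : ℤ_[p]) ^ a := by
    rw [map_pow, show κ γ = Multiplicative.ofAdd 1 from hγ, ← ofAdd_nsmul, toAdd_ofAdd, nsmul_eq_mul, mul_one,
      Nat.cast_pow]
  have hh₀ : (g₀ ^ Nrm.toSubgroup.index)⁻¹ * γ ^ p ^ a ∈ H' := by
    rw [hH']
    refine ⟨?_, R.mul_mem (R.inv_mem (R.pow_mem hg₀R _)) (R.pow_mem hγR _)⟩
    rw [ZpExtension.mem_kerSubgroup, map_mul, map_inv]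
    apply Multiplicative.toAdd.injective
    rw [toAdd_mul, toAdd_inv, hκτ, hκγ, toAdd_one, neg_add_cancel]
  refine ⟨a, ?_⟩
  conv_lhs => rw [← mul_inv_cancel_left (g₀ ^ Nrm.toSubgroup.index) (γ ^ p ^ a)]
  rw [conjH1_mul_holds H' M, AddMonoidHom.comp_apply, conjH1_of_mem_holds H' M hh₀, AddMonoidHom.id_apply]
  exact hNrm _ hτN

end Continuity

/-! ## §2 Local nilpotence of `γ − 1` on a `conj_γ`-stable subgroup of `H¹(H′, M)`; `p′`-multiplication on `p`-primary `M` -/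

section LocNil

variable (H' : Subgroup (absoluteGaloisGroup K)) [H'.Normal]

omit [Fact p.Prime] [H'.Normal] in
/-- Every class of `H¹(H′, M)` is killed by a power of `p` when `H′` is closed (compact) and `M` is `p`-primary: the cocycle
takes finitely many values. [cite: GreenbergLNM1716, §1 (after Conj. 1.3)] -/
theorem exists_pow_smul_eq_zero (hH'c : IsClosed (H' : Set (absoluteGaloisGroup K)))
    (htor : ∀ m : M, ∃ k : ℕ, p ^ k • m = 0) (c : subgroupH1 H' M) : ∃ k : ℕ, p ^ k • c = 0 := by
  haveI : CompactSpace H' := isCompact_iff_compactSpace.mp hH'c.isCompact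
  obtain ⟨φ, rfl⟩ := oneCocycleClass_surjective _ c
  exact IwasawaDual.exists_pow_smul_oneCocycleClass_eq_zero φ fun σ ↦ htor _

omit [NumberField K] [Fact p.Prime] in
/-- Powers of an endomorphism `f` of a subgroup `S ≤ H¹(H′, M)` which is the (co)restriction of `conj_γ` are the (co)restrictions
of `conj_{γ^m}`. [folklore] -/
theorem coe_pow_apply_of_eq_conjH1 (γ : absoluteGaloisGroup K) (S : AddSubgroup (subgroupH1 H' M)) (f : AddMonoid.End S)
    (hf : ∀ s : S, ((f s : S) : subgroupH1 H' M) = conjH1 H' M γ s) (m : ℕ) (s : S) :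
    (((f ^ m) s : S) : subgroupH1 H' M) = conjH1 H' M (γ ^ m) s := by
  induction m generalizing s with
  | zero => rw [pow_zero, pow_zero, AddMonoid.End.one_apply, conjH1_one_holds H' M, AddMonoidHom.id_apply]
  | succ m ih =>
    rw [pow_succ, AddMonoid.End.coe_mul, Function.comp_apply, ih, hf, pow_succ, conjH1_mul_holds H' M,
      AddMonoidHom.comp_apply]

/-- **`IsLocNil p (conj_γ|_S − 1)` for every `conj_γ`-stable subgroup `S ≤ H¹(H′, M)`** in the setting of (A2′) (`H′ = ker κ ∩ R`
closed normal, `κ|_R` onto, `γ ∈ R` a topological generator, `M` `p`-primary with open stabilisers), for any endomorphism `f` of `S`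
that is the (co)restriction of `conj_γ`: every class is killed by some `p^k` and fixed by some `conj_{γ^{p^a}}`, hence killed by
`(f − 1)^{k p^a}` (`IwasawaDual.pow_mul_prime_pow_apply_eq_zero`). This is the hypothesis of the tree's `IwasawaDual.IsLocNil.module`,
making `Hom(S, ℚ/ℤ)` a `Λ = ℤ_p⟦T⟧`-module with `1 + T ↦ γ`. [cite: GreenbergLNM1716, §1 (after Conj. 1.3)]
[cite: Castella2018, §2.2 ("`1 + T ↦ γ`")] -/
theorem isLocNil_sub_one_of_eq_conjH1 (κ : ZpExtension K p) (R : Subgroup (absoluteGaloisGroup K))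
    (hH' : ∀ x, x ∈ H' ↔ x ∈ κ.kerSubgroup ∧ x ∈ R)
    (hR : ∀ u : ℤ_[p], ∃ g ∈ R, κ g = Multiplicative.ofAdd u)
    (hH'c : IsClosed (H' : Set (absoluteGaloisGroup K)))
    (hstab : ∀ m : M, IsOpen (MulAction.stabilizer (absoluteGaloisGroup K) m : Set (absoluteGaloisGroup K)))
    (htor : ∀ m : M, ∃ k : ℕ, p ^ k • m = 0)
    {γ : absoluteGaloisGroup K} (hγ : κ.IsTopGenerator γ) (hγR : γ ∈ R)
    (S : AddSubgroup (subgroupH1 H' M)) (f : AddMonoid.End S)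
    (hf : ∀ s : S, ((f s : S) : subgroupH1 H' M) = conjH1 H' M γ s) :
    IwasawaDual.IsLocNil p (f - 1) := by
  have htorS : ∀ s : S, ∃ k : ℕ, p ^ k • s = 0 := fun s ↦ by
    obtain ⟨k, hk⟩ := exists_pow_smul_eq_zero M H' hH'c htor (s : subgroupH1 H' M)
    exact ⟨k, Subtype.ext (by rw [AddSubgroupClass.coe_nsmul]; exact hk)⟩
  refine ⟨htorS, fun s ↦ ?_⟩
  obtain ⟨a, ha⟩ := exists_conjH1_pow_prime_pow_eq M H' κ R hH' hR hH'c hstab hγ hγR (s : subgroupH1 H' M)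
  obtain ⟨k, hk⟩ := htorS s
  have hφ : (f ^ p ^ a) s = s := Subtype.ext (by rw [coe_pow_apply_of_eq_conjH1 M H' γ S f hf]; exact ha)
  exact ⟨k * p ^ a, IwasawaDual.pow_mul_prime_pow_apply_eq_zero (Fact.out : p.Prime) _ a hφ hk⟩

omit [NumberField K] [Fact p.Prime] in
variable {M} in
/-- **On a `p`-primary group, multiplication by `n` prime to `p` is bijective** (Bézout: `u n + v p^k = 1` on the `p^k`-torsion
element). [folklore] -/
theorem nsmul_bijective_of_isPrimary {A : Type*} [AddCommGroup A] (htor : ∀ m : A, ∃ k : ℕ, p ^ k • m = 0) {n : ℕ}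
    (hn : n.Coprime p) : Function.Bijective fun m : A ↦ n • m := by
  -- Bézout on each element
  have key : ∀ m : A, ∃ u : ℤ, m = n • (u • m) := fun m ↦ by
    obtain ⟨k, hk⟩ := htor m
    obtain ⟨u, v, huv⟩ := Nat.isCoprime_iff_coprime.mpr (hn.pow_right k)
    refine ⟨u, ?_⟩
    have e : (1 : ℤ) • m = (u * (n : ℤ) + v * ((p ^ k : ℕ) : ℤ)) • m := by rw [huv]
    rw [one_zsmul, add_zsmul, mul_zsmul, mul_zsmul, natCast_zsmul, natCast_zsmul, hk, zsmul_zero, add_zero] at e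
    rw [smul_comm]
    exact e
  refine ⟨fun m m' (h : n • m = n • m') ↦ ?_, fun m ↦ ?_⟩
  · obtain ⟨u, hu⟩ := key (m - m')
    have h0 : n • (m - m') = 0 := by rw [nsmul_sub, h, sub_self]
    rw [smul_comm, h0, zsmul_zero] at hu
    exact sub_eq_zero.mp hu
  · obtain ⟨u, hu⟩ := key m
    exact ⟨u • m, hu.symm⟩

end LocNil

/-! ## §3 Coefficient endomorphisms `φ_* = resH1Hom (id, φ)` on `H¹(H′, M)` and on `Sel_𝔭^Σ(K̄^{H′}, M)` -/

section CoeffGeneric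

variable {G : Type u} [Group G] [TopologicalSpace G] [IsTopologicalGroup G]
variable (N : Type u) [AddCommGroup N] [DistribMulAction G N] [TopologicalSpace N] [DiscreteTopology N]
variable {A B : Subgroup G}

/-- The map induced on `H¹` by the NEGATIVE of a compatible coefficient map is the negative (classes of negated cocycles).
[folklore] -/
theorem resH1Hom_neg {G' : Type u} [Group G'] [TopologicalSpace G'] [IsTopologicalGroup G'] {N' : Type u} [AddCommGroup N']
    [DistribMulAction G' N'] [TopologicalSpace N'] [DiscreteTopology N'] (θ : G' →ₜ* G) (ψ : N →+ N')
    (h : ∀ (x : G') (m : N), ψ (θ x • m) = x • ψ m) (h' : ∀ (x : G') (m : N), (-ψ) (θ x • m) = x • (-ψ) m)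
    (c : discreteH1 G N) : resH1Hom θ (-ψ) h' c = -resH1Hom θ ψ h c := by
  obtain ⟨f, rfl⟩ := oneCocycleClass_surjective _ c
  rw [resH1Hom_oneCocycleClass, resH1Hom_oneCocycleClass, ← oneCocycleClass_neg']
  congr 1

/-- **`φ_*` commutes with restriction**: for `A ≤ B` and `φ : N → N` commuting with `B`,
`res_{B→A} ∘ φ_* = φ_* ∘ res_{B→A}` (both are the map of the pair `(A ↪ B, φ)`). [cite: NeukirchSchmidtWingberg2008, I.§5] -/
theorem resOfLe_resH1Hom_coeff (h : A ≤ B) (φ : N →+ N) (hφ : ∀ (x : B) (m : N), φ (x • m) = x • φ m) (c : subgroupH1 B N) :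
    resOfLe N h (resH1Hom (ContinuousMonoidHom.id B) φ hφ c) =
      resH1Hom (ContinuousMonoidHom.id A) φ (fun x m ↦ hφ ⟨x, h x.2⟩ m) (resOfLe N h c) := by
  rw [resOfLe, resH1Hom_resH1Hom, resH1Hom_resH1Hom]
  exact DFunLike.congr_fun (resH1Hom_congr (by ext; rfl) (by ext; rfl) _ _) c

/-- **`φ_*` commutes with `conj_σ` when `φ` commutes with `σ`** (`A` normal): both composites are the map of the pair
`(a ↦ σ⁻¹ a σ, m ↦ σ • φ m = φ (σ • m))`. [cite: NeukirchSchmidtWingberg2008, I.§5] -/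
theorem conjH1_resH1Hom_coeff_of_comm [A.Normal] (φ : N →+ N) (hφ : ∀ (x : A) (m : N), φ (x • m) = x • φ m) {σ : G}
    (hσ : ∀ m : N, φ (σ • m) = σ • φ m) (c : subgroupH1 A N) :
    conjH1 A N σ (resH1Hom (ContinuousMonoidHom.id A) φ hφ c) =
      resH1Hom (ContinuousMonoidHom.id A) φ hφ (conjH1 A N σ c) := by
  rw [conjH1, resH1Hom_resH1Hom, resH1Hom_resH1Hom]
  exact DFunLike.congr_fun (resH1Hom_congr (by ext; rfl) (by ext m; exact (hσ m).symm) _ _) c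

/-- **`φ_*` ANTI-commutes with `conj_σ` when `φ` anti-commutes with `σ`** (`A` normal): `conj_σ ∘ φ_* = −φ_* ∘ conj_σ`
(the pairs differ by the sign of the coefficient map). For the CM endomorphism `φ = [√d]` of a CM curve over a field not
containing `√d` and `σ` acting non-trivially on `√d`: `σ ∘ [√d] = [−√d] ∘ σ`. [cite: SilvermanAEC2009, II.2 (`(φP)^σ = φ^σ(P^σ)`)] -/
theorem conjH1_resH1Hom_coeff_of_anticomm [A.Normal] (φ : N →+ N) (hφ : ∀ (x : A) (m : N), φ (x • m) = x • φ m) {σ : G}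
    (hσ : ∀ m : N, φ (σ • m) = -(σ • φ m)) (c : subgroupH1 A N) :
    conjH1 A N σ (resH1Hom (ContinuousMonoidHom.id A) φ hφ c) =
      -resH1Hom (ContinuousMonoidHom.id A) φ hφ (conjH1 A N σ c) := by
  have hneg : ∀ (x : A) (m : N), (-φ) (x • m) = x • (-φ) m := fun x m ↦ by
    rw [AddMonoidHom.neg_apply, AddMonoidHom.neg_apply, hφ, smul_neg]
  have hψ : (DistribSMul.toAddMonoidHom N σ).comp φ = (-φ).comp (DistribSMul.toAddMonoidHom N σ) := by
    ext m
    change σ • φ m = (-φ) (σ • m)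
    rw [AddMonoidHom.neg_apply, hσ, neg_neg]
  rw [← resH1Hom_neg N (ContinuousMonoidHom.id A) φ hφ hneg, conjH1, resH1Hom_resH1Hom, resH1Hom_resH1Hom]
  exact DFunLike.congr_fun (resH1Hom_congr (by ext; rfl) hψ _ _) c

end CoeffGeneric

section CoeffSelmer

variable {H' : Subgroup (absoluteGaloisGroup K)} [H'.Normal]

omit [Fact p.Prime] [TopologicalSpace M] [DiscreteTopology M] [H'.Normal] in
variable {M} in
/-- A map `φGr` induced by `φ` on `M ⧸ 0 = (strictDatum M v).Gr` (`φGr ∘ grMk = grMk ∘ φ`) is compatible with the action of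
`H′ ⊓ D_v` when `φ` commutes with `H′`. [folklore] -/
theorem strictDatum_gr_smul_comm (v : HeightOneSpectrum (𝓞 K)) (φ : M →+ M) (hφ : ∀ (x : H') (m : M), φ (x • m) = x • φ m)
    (φGr : (strictDatum M v).Gr →+ (strictDatum M v).Gr)
    (hφGr : ∀ m : M, φGr ((strictDatum M v).grMk m) = (strictDatum M v).grMk (φ m))
    (x : decompIn H' v) (m : (strictDatum M v).Gr) : φGr (x • m) = x • φGr m := by
  obtain ⟨m, rfl⟩ := (strictDatum M v).grMk_surjective m
  have hx : ((x : decomp (K := K) v) : absoluteGaloisGroup K) ∈ H' := (mem_decompIn_iff H' v x).1 x.2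
  change φGr ((x : decomp (K := K) v) • (strictDatum M v).grMk m) = (x : decomp (K := K) v) • φGr ((strictDatum M v).grMk m)
  rw [LocalDatum.smul_grMk, hφGr, hφGr, LocalDatum.smul_grMk]
  exact congrArg _ (hφ ⟨_, hx⟩ m)

omit [Fact p.Prime] [H'.Normal] in
variable {M} in
/-- **The strict local map commutes with `φ_*`** (strict datum `M⁺ = 0`): `strictMap ∘ φ_* = (φGr)_* ∘ strictMap` for any `φGr`
induced by `φ` on `M ⧸ 0`, both being the map of the pair `(H′ ⊓ D_v → H′, grMk ∘ φ = φGr ∘ grMk)`. [cite: Greenberg1989, §1 p. 98] -/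
theorem strictMap_resH1Hom_coeff (v : HeightOneSpectrum (𝓞 K)) (φ : M →+ M) (hφ : ∀ (x : H') (m : M), φ (x • m) = x • φ m)
    (φGr : (strictDatum M v).Gr →+ (strictDatum M v).Gr)
    (hφGr : ∀ m : M, φGr ((strictDatum M v).grMk m) = (strictDatum M v).grMk (φ m)) (c : subgroupH1 H' M) :
    (strictDatum M v).strictMap H' (resH1Hom (ContinuousMonoidHom.id H') φ hφ c) =
      resH1Hom (ContinuousMonoidHom.id (decompIn H' v)) φGr (strictDatum_gr_smul_comm v φ hφ φGr hφGr)
        ((strictDatum M v).strictMap H' c) := by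
  have hψ : ((strictDatum M v).grMk).comp φ = φGr.comp (strictDatum M v).grMk := by
    ext m
    exact (hφGr m).symm
  rw [LocalDatum.strictMap, resH1Hom_resH1Hom, resH1Hom_resH1Hom]
  exact DFunLike.congr_fun (resH1Hom_congr (by ext; rfl) hψ _ _) c

/-- **`φ_*` preserves Castella's Selmer group `Sel_𝔭^Σ(K̄^{H′}, M)`** for an `H′`-equivariant `φ : M → M` which every `σ ∈ Γ_K`
either commutes or anti-commutes with: `conj_σ (φ_* c) = ±φ_* (conj_σ c)`, and `φ_*` commutes with every local map (away, at
infinity, strict at `𝔭`), so all local conditions are preserved (kernels are stable under sign). The CM endomorphism `[√d]` of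
`E[p^∞]` over the Heegner field `K′ ∌ √d` is such a `φ`. [cite: Castella2018, Def. 2.2] [cite: SilvermanAEC2009, II.2] -/
theorem resH1Hom_coeff_mem_selmerOver (φ : M →+ M) (hφ : ∀ (x : H') (m : M), φ (x • m) = x • φ m)
    (hφσ : ∀ σ : absoluteGaloisGroup K, (∀ m, φ (σ • m) = σ • φ m) ∨ (∀ m, φ (σ • m) = -(σ • φ m)))
    {pp : ℕ} {𝔭 : HeightOneSpectrum (𝓞 K)} {S : Set (HeightOneSpectrum (𝓞 K))} {c : subgroupH1 H' M}
    (hc : c ∈ selmerOver H' M pp 𝔭 S) : resH1Hom (ContinuousMonoidHom.id H') φ hφ c ∈ selmerOver H' M pp 𝔭 S := by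
  -- `conj_σ (φ_* c)` is `± φ_* (conj_σ c)`; membership in a subgroup is insensitive to the sign
  have key : ∀ (σ : absoluteGaloisGroup K) (T : AddSubgroup (subgroupH1 H' M)),
      resH1Hom (ContinuousMonoidHom.id H') φ hφ (conjH1 H' M σ c) ∈ T →
        conjH1 H' M σ (resH1Hom (ContinuousMonoidHom.id H') φ hφ c) ∈ T := fun σ T hT ↦ by
    rcases hφσ σ with hσ | hσ
    · rw [conjH1_resH1Hom_coeff_of_comm M φ hφ hσ]; exact hT
    · rw [conjH1_resH1Hom_coeff_of_anticomm M φ hφ hσ]; exact T.neg_mem hT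
  -- the map induced by `φ` on `M ⧸ 0`
  let φGr : (strictDatum M 𝔭).Gr →+ (strictDatum M 𝔭).Gr :=
    QuotientAddGroup.map (strictDatum M 𝔭).plus (strictDatum M 𝔭).plus φ fun y hy ↦ by
      have hy0 : y = 0 := (AddSubgroup.mem_bot).1 hy
      rw [AddSubgroup.mem_comap, hy0, map_zero]
      exact AddSubgroup.zero_mem _
  have hφGr : ∀ m : M, φGr ((strictDatum M 𝔭).grMk m) = (strictDatum M 𝔭).grMk (φ m) := fun m ↦ rfl
  rw [mem_selmerOver_iff] at hc ⊢
  refine ⟨fun v hv hvS σ ↦ key σ _ ?_, fun w σ ↦ key σ _ ?_, fun σ ↦ key σ _ ?_⟩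
  · rw [awayKer, AddMonoidHom.mem_ker, resOfLe_resH1Hom_coeff,
      (AddMonoidHom.mem_ker.1 (hc.1 v hv hvS σ) : resOfLe M _ _ = 0), map_zero]
  · rw [infKer, AddMonoidHom.mem_ker, resOfLe_resH1Hom_coeff,
      (AddMonoidHom.mem_ker.1 (hc.2.1 w σ) : resOfLe M _ _ = 0), map_zero]
  · rw [LocalDatum.mem_strictKer_iff, strictMap_resH1Hom_coeff 𝔭 φ hφ φGr hφGr,
      (LocalDatum.mem_strictKer_iff _ _ _).1 (hc.2.2 σ), map_zero]

end CoeffSelmer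

end Summit.BirchSwinnertonDyer.BirchSwinnertonDyer.Theorems.BiquadraticEisensteinDescentEisensteinHeartFlatCMInertBadKPrimeSelmerTower

end
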